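import Summits.QuantumFields.BalabanUV.T4Continuum.Support.ShellMeasureRootCompositionHistoriesEnd
import Summits.QuantumFields.BalabanUV.T4Continuum.Support.ShellMeasureRootCompositionSync

/-!
# `T4Continuum.ShellMeasureRootCompositionHistoriesSync` — file 4 of the history-indexed (R)+[dict] push: the
# histories ledger and its END with SLOT-INDEXED THRESHOLDS `θ K s` (one more free index; the D8 age-synchronised
# thresholds `ε (K − lvl K s)` as the instance), composed with leaf-09's `ShellMeasureRootCompositionSync`
# (cell `pub-balaban`, sub-cell `t4`, spine estimate NE7c (node U5b); NE7c ROUND-2 crew `t4-ne7c-formalise-*`, unit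
# `b2b-balaban-t4-ne7c-formalise-leaf-05` gen 3; follow-up of this lineage's OFFERED row «(R)+[dict] PUSH AT ALL LEVELS,
# HISTORY-INDEXED TERMS» (files 1–3: p210200, p210501, p211019) after FINDING F-ne7cleaf09-3 (journal l.7772, candidate
# T-NE7c-7); ADDITIVE — imports file 2 `ShellMeasureRootCompositionHistoriesEnd` and `ShellMeasureRootCompositionSync`
# (p211299) only; 0 def, 0 sorry, 0 cite)

HONEST FRAMING.  Finite four-torus programme, rung (B)+1 only — NOT infinite volume, NOT a mass gap, NOT the Clay
problem, NOT summit progress.  NE7c = `T4IndicatorShell.ShellWeightBound` is NOT PRINTED in [Balaban 1983–89] and NOT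
PROVED; END-I is the COMPOSITION «NE7c ⇐ the named binders» (trigger c3) and this file, like files 1–2, discharges only
its BOOKKEEPING binders.  Nothing of the audited series is asserted.  HONEST DEPENDENCY (cell): continuum YM on T⁴ ⇐
BetaPertH ∧ nine spine estimates (0/9 proved); BetaPertH ⇐ (D1) ∧ (D4) ∧ CAP+tail; G-an2-4 gates asym, D1 and NE2/3/4.

WHY THIS FILE (F-ne7cleaf09-3, type-level, on OUR composition).  Files 1–2 read the threshold of slot `s` of comparison
`K` as `θ (lvl K s)` from ONE sequence `θ : ℕ → ℝ` — END-I's typing.  Under the cell's design D8 (`T4SyncThresholds`: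
every threshold parameter is a function of the IR-anchored AGE `n = K − k` through one reference sequence) a level `j`
is live at the `N₁ + 1` comparison indices `K = j, …, j + N₁`, i.e. at ages `0, …, N₁`, so a level-indexed threshold
would have to take `N₁ + 1` design values at once (`ShellMeasureRootCompositionSync.window_depth_zero_of_levelIndexed_
oneLoopRef`: depth `N₁ = 0` forced for an injective profile).  File 1's OBJECTS (§2 there: `smallProd`, `histWeight`,
`histShell`, `histPiece`, `histLaw`, `partialLaw` and all their lemmas) already take a FREE threshold assignment
`ϑ : σ → ℝ`; only file 1 §3 ∕ file 2 specialised it to `fun s => θ (lvl K s)`.  Here the same six (R)+[dict] binders, the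
plug and the END are stated for `θ : ℕ → σ → ℝ` (threshold of slot `s` at comparison `K` = `θ K s`) and composed with
`ShellMeasureRootCompositionSync.levelLedger_of_slotAC_sync` ∕ `shellWeightBound_of_slotAC_sync` (END-I re-typed with
slot-indexed thresholds, leaf-09 gen 3).  Widths `ρ` (node U1b's rate) and constants `D ≤ D̄` stay BY LEVEL.

WHAT IS PROVED ([folklore]; every item a one-line instance of file 1 §2 or of `…Sync` §1).  §6 the binders
`sh_nonneg_sync`, `sh_le_sync`, `cover_sync`, `piece_le_sync` (⇐ a.e. closeness `|u^A_s − u^B_s| ≤ ρ_{lvl s}·θ K s` under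
every history weight in which `s` is live-small — node U1b-type INPUT, displayed, never minted), `total_ge_sync`
(AUTOMATIC, `M ≡ 1`).  §7 `hac_of_histories_sync` ((M1) per history ⇒ (M1) for the partial law, threshold `θ K s`),
`levelLedger_histories_sync`, `omega_histories_sync`, **`shellWeightBound_histories_sync`** (rate form) and
**`shellWeightBound_histories_sync_band`** (road P2's band head, c6) — conclusion LITERALLY
`T4IndicatorShell.ShellWeightBound l₀ T A B shA shB Wsh` with END-I's `Wsh K = Σ_{s∈C K} D^A_{lvl s}ρ_{lvl s} + Σ D^B…`.
§8 NOTHING LANDED IS LOST: file 2's `levelLedger_histories` ∕ `shellWeightBound_histories` are the case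
`θ K s := θ' (lvl K s)` (two `example`s, same binders, same conclusion); and THE D8 INSTANCE
**`shellWeightBound_histories_age`**: thresholds `ε (K − lvl K s)` by AGE (both runs' paired slots of comparison `K`
have the same age under node U1b's `ReadsLevels` convention — run B = the `(K+1)`-step run, its level-`(j+1)` slot
paired with run A's level-`j` slot —, so ONE profile `ε` serves the comparison; nothing about `ε` is assumed).

WHAT THIS DOES NOT DO.  No (M1) (the wall — per slot per run for the partial laws, at live levels SM-L1…SM-L5 through
END-II), no window∕count (S9), no rate (U1b), no identification of `ε` with Bałaban's `ε(ḡ_n)` beyond the words above;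
NE7c NOT proved; 0/9 spine.
-/

noncomputable section

open MeasureTheory Finset Filter
open scoped ENNReal

namespace Summit.QuantumFields.BalabanUV.T4Continuum.ShellMeasureRootCompositionHistoriesSync

open Literature.MathematicalPhysics.QuantumFieldTheory.Balaban1983to89
open ShellMeasureRootCompositionHistories
open ShellMeasureRootCompositionHistoriesEnd (levelLedger_histories shellWeightBound_histories)
open ShellMeasureRootCompositionSync (levelLedger_of_slotAC_sync shellWeightBound_of_slotAC_sync)
open ShellMeasureBandCount (shellWeightBound_of_levels_band)
open T4IndicatorShell (ShellWeightBound)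
open T4ShellMeasure (SlotAntiConcentration)
open T4ShellMeasureLevels (LevelLedger LiveWindow)

/-! ## §6 END-I's per-run binders for history-indexed terms, thresholds BY SLOT `θ K s` -/

section Binders

variable {Ω : ℕ → Type*} [∀ K, MeasurableSpace (Ω K)] {σ ι : Type*} [DecidableEq σ] (T : ℕ → Finset ι)
  (C : ℕ → Finset σ) (small : ℕ → ι → Finset σ) (lvl : ℕ → σ → ℕ) (ν : ∀ K : ℕ, ℝ → ι → Measure (Ω K))
  [∀ K t τ, IsFiniteMeasure (ν K t τ)] (uA uB : ∀ K : ℕ, ℝ → σ → Ω K → ℝ) (θ : ℕ → σ → ℝ) (ρ : ℕ → ℝ) (l₀ : ℝ)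

omit [DecidableEq σ] [∀ K t τ, IsFiniteMeasure (ν K t τ)] in
/-- (R) `sh_nonneg`, thresholds by slot. [folklore] -/
theorem sh_nonneg_sync : ∀ K t, |t| ≤ l₀ → ∀ τ ∈ T K,
    0 ≤ histShell (ν K t τ) (small K τ) (uA K t) (uB K t) (θ K) :=
  fun K t _ τ _ => histShell_nonneg (ν K t τ) (small K τ) (uA K t) (uB K t) _

omit [DecidableEq σ] in
/-- (R) `sh_le`, thresholds by slot: the shell part of a history never exceeds its weight. [folklore] -/
theorem sh_le_sync (huA : ∀ K t s, Measurable (uA K t s)) : ∀ K t, |t| ≤ l₀ → ∀ τ ∈ T K,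
    histShell (ν K t τ) (small K τ) (uA K t) (uB K t) (θ K) ≤ histWeight (ν K t τ) (small K τ) (uA K t) (θ K) :=
  fun K t _ τ _ => histShell_le_histWeight (ν K t τ) (small K τ) (huA K t) (uB K t) _

/-- (R) `cover`, thresholds by slot: a history's shell part is covered by its per-slot pieces over the live slots
`C K ⊇ small K τ`. [folklore] -/
theorem cover_sync (huA : ∀ K t s, Measurable (uA K t s)) (huB : ∀ K t s, Measurable (uB K t s))
    (hsmall : ∀ K, ∀ τ ∈ T K, small K τ ⊆ C K) : ∀ K t, |t| ≤ l₀ → ∀ τ ∈ T K,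
    histShell (ν K t τ) (small K τ) (uA K t) (uB K t) (θ K) ≤
      ∑ s ∈ C K, histPiece (ν K t τ) (small K τ) (uA K t) (uB K t) (θ K) s :=
  fun K t _ τ hτ => histShell_le_sum_piece (ν K t τ) (hsmall K τ hτ) (huA K t) (huB K t) _

/-- **[dict] PUSH `piece_le`, thresholds by slot, `M = 1`**: under a.e. `ρ_{lvl s}·θ_{K,s}`-closeness of the two
tested variables of a live slot `s` on the support of every history weight in which `s` is live-small, its pieces weigh
at most the `s`-small partial law's mass of the run's OWN shell `{θ_{K,s}(1 − ρ_{lvl s}) ≤ u^A_s < θ_{K,s}}`. [folklore] -/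
theorem piece_le_sync (huA : ∀ K t s, Measurable (uA K t s))
    (hclose : ∀ K t, |t| ≤ l₀ → ∀ τ ∈ T K, ∀ s ∈ small K τ,
      ∀ᵐ ω ∂(ν K t τ), |uA K t s ω - uB K t s ω| ≤ ρ (lvl K s) * θ K s) :
    ∀ K t, |t| ≤ l₀ → ∀ s ∈ C K,
      ∑ τ ∈ T K, histPiece (ν K t τ) (small K τ) (uA K t) (uB K t) (θ K) s ≤
        1 * ((partialLaw (T K) (ν K t) (small K) (uA K t) (θ K) s)
          {x | θ K s * (1 - ρ (lvl K s)) ≤ uA K t s x ∧ uA K t s x < θ K s}).toReal :=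
  fun K t ht s _ => sum_histPiece_le (T K) (ν K t) (small K) (huA K t) (ρ := ρ (lvl K s))
    fun τ hτ hs => hclose K t ht τ hτ s hs

/-- **[dict] PUSH `total_ge`, thresholds by slot — AUTOMATIC**: `1 × μ_s(univ) = Σ_{τ∋s} A_τ ≤ Σ_τ A_τ`. [folklore] -/
theorem total_ge_sync (huA : ∀ K t s, Measurable (uA K t s)) : ∀ K t, |t| ≤ l₀ → ∀ s ∈ C K,
    1 * ((partialLaw (T K) (ν K t) (small K) (uA K t) (θ K) s) Set.univ).toReal ≤
      ∑ τ ∈ T K, histWeight (ν K t τ) (small K τ) (uA K t) (θ K) :=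
  fun K t _ s _ => partialLaw_univ_le_sum (T K) (ν K t) (small K) (huA K t) _ s

end Binders

/-! ## §7 The plug and END-I fired, thresholds BY SLOT -/

section Plug

variable {Ω : ℕ → Type*} [∀ K, MeasurableSpace (Ω K)] {σ ι : Type*} [DecidableEq σ] {T : ℕ → Finset ι}
  {C : ℕ → Finset σ} {small : ℕ → ι → Finset σ} {lvl : ℕ → σ → ℕ} {ν : ∀ K : ℕ, ℝ → ι → Measure (Ω K)}
  [∀ K t τ, IsFiniteMeasure (ν K t τ)] {uA uB : ∀ K : ℕ, ℝ → σ → Ω K → ℝ} {θ : ℕ → σ → ℝ} {ρ D : ℕ → ℝ} {l₀ : ℝ}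

omit [∀ K t τ, IsFiniteMeasure (ν K t τ)] in
/-- **(M1) FOR A PARTIAL LAW FROM (M1) PER HISTORY**, threshold `θ K s` (file 1 §1 additivity). [folklore] -/
theorem hac_of_histories_sync
    (hach : ∀ K t, |t| ≤ l₀ → ∀ s ∈ C K, ∀ τ ∈ T K, s ∈ small K τ →
      SlotAntiConcentration (histLaw (ν K t τ) (small K τ) (uA K t) (θ K)) (uA K t s)
        (θ K s) (ρ (lvl K s)) (D (lvl K s))) :
    ∀ K t, |t| ≤ l₀ → ∀ s ∈ C K,
      SlotAntiConcentration (partialLaw (T K) (ν K t) (small K) (uA K t) (θ K) s) (uA K t s)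
        (θ K s) (ρ (lvl K s)) (D (lvl K s)) :=
  fun K t ht s hs => slotAntiConcentration_finsetSum _ _ fun τ hτ =>
    hach K t ht s hs τ (Finset.mem_filter.1 hτ).1 (Finset.mem_filter.1 hτ).2

/-- **EVERY LEVEL, HISTORY-INDEXED TERMS, THRESHOLDS BY SLOT: `LevelLedger` ⇐ (M1) PER SLOT FOR ITS PARTIAL LAW.**
File 2's `levelLedger_histories` with the threshold of slot `s` at comparison `K` read as `θ K s`; composed with
`ShellMeasureRootCompositionSync.levelLedger_of_slotAC_sync`.  Displayed: measurability, `small ⊆ C`, the a.e. closeness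
(node U1b type), signs, THE WALL `hac`.  CONDITIONAL on `hac`; nothing printed asserted. [folklore] -/
theorem levelLedger_histories_sync (huA : ∀ K t s, Measurable (uA K t s)) (huB : ∀ K t s, Measurable (uB K t s))
    (hsmall : ∀ K, ∀ τ ∈ T K, small K τ ⊆ C K)
    (hclose : ∀ K t, |t| ≤ l₀ → ∀ τ ∈ T K, ∀ s ∈ small K τ,
      ∀ᵐ ω ∂(ν K t τ), |uA K t s ω - uB K t s ω| ≤ ρ (lvl K s) * θ K s)
    (hD : ∀ j, 0 ≤ D j) (hρ : ∀ j, 0 ≤ ρ j)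
    (hac : ∀ K t, |t| ≤ l₀ → ∀ s ∈ C K,
      SlotAntiConcentration (partialLaw (T K) (ν K t) (small K) (uA K t) (θ K) s) (uA K t s)
        (θ K s) (ρ (lvl K s)) (D (lvl K s))) :
    LevelLedger l₀ T (fun K t τ => histWeight (ν K t τ) (small K τ) (uA K t) (θ K))
      (fun K t τ => histShell (ν K t τ) (small K τ) (uA K t) (uB K t) (θ K)) C
      (fun K t s τ => histPiece (ν K t τ) (small K τ) (uA K t) (uB K t) (θ K) s) lvl D ρ := by
  haveI : ∀ K t s, IsFiniteMeasure (partialLaw (T K) (ν K t) (small K) (uA K t) (θ K) s) :=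
    fun K t s => isFiniteMeasure_partialLaw _ _ _ _ _ _
  exact levelLedger_of_slotAC_sync (Ω := fun K _ => Ω K)
    (μ := fun K t s => partialLaw (T K) (ν K t) (small K) (uA K t) (θ K) s)
    (u := fun K t s => uA K t s) (θ := θ) (M := fun _ _ _ => (1 : ℝ))
    (sh_nonneg_sync T small ν uA uB θ l₀) (sh_le_sync T small ν uA uB θ l₀ huA)
    (cover_sync T C small ν uA uB θ l₀ huA huB hsmall) (ShellMeasureRootCompositionPushCubes.M_nonneg C l₀)
    (piece_le_sync T C small lvl ν uA uB θ ρ l₀ huA hclose) (total_ge_sync T C small ν uA θ l₀ huA) hD hρ hac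

/-- the relative shell weight booked at cutoff `K` is END-I's summand `Σ_{s∈C K} D_{lvl s}·ρ_{lvl s}` (thresholds do not
enter). [folklore] -/
theorem omega_histories_sync (huA : ∀ K t s, Measurable (uA K t s)) (huB : ∀ K t s, Measurable (uB K t s))
    (hsmall : ∀ K, ∀ τ ∈ T K, small K τ ⊆ C K)
    (hclose : ∀ K t, |t| ≤ l₀ → ∀ τ ∈ T K, ∀ s ∈ small K τ,
      ∀ᵐ ω ∂(ν K t τ), |uA K t s ω - uB K t s ω| ≤ ρ (lvl K s) * θ K s)
    (hD : ∀ j, 0 ≤ D j) (hρ : ∀ j, 0 ≤ ρ j)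
    (hac : ∀ K t, |t| ≤ l₀ → ∀ s ∈ C K,
      SlotAntiConcentration (partialLaw (T K) (ν K t) (small K) (uA K t) (θ K) s) (uA K t s)
        (θ K s) (ρ (lvl K s)) (D (lvl K s))) (K : ℕ) :
    (levelLedger_histories_sync huA huB hsmall hclose hD hρ hac).toSlotLedger.omega K =
      ∑ s ∈ C K, D (lvl K s) * ρ (lvl K s) :=
  T4ShellMeasureLevels.LevelLedger.omega_eq (levelLedger_histories_sync huA huB hsmall hclose hD hρ hac) K

end Plug

section TwoRuns

variable {Ω : ℕ → Type*} [∀ K, MeasurableSpace (Ω K)] {σ ι : Type*} [DecidableEq σ] {T : ℕ → Finset ι}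
  {C : ℕ → Finset σ} {small : ℕ → ι → Finset σ} {lvl : ℕ → σ → ℕ} {νA νB : ∀ K : ℕ, ℝ → ι → Measure (Ω K)}
  [∀ K t τ, IsFiniteMeasure (νA K t τ)] [∀ K t τ, IsFiniteMeasure (νB K t τ)]
  {uA uB : ∀ K : ℕ, ℝ → σ → Ω K → ℝ} {θ : ℕ → σ → ℝ} {ρ DA DB : ℕ → ℝ} {l₀ : ℝ} {N₁ : ℕ} {νbar Dbar c₁ ϑ : ℝ}
  {m : ℕ → ℝ}

/-- **END-I FOR HISTORY-INDEXED TERM FAMILIES, THRESHOLDS BY SLOT — `ShellWeightBound` ⇐ measurability + closeness +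
(M1) per slot per run FOR THE PARTIAL LAWS + (W1) + `D ≤ D̄` + rate.**  File 2's `shellWeightBound_histories` with the
common threshold of slot `s` at comparison `K` read as `θ K s` (`θ : ℕ → σ → ℝ`); composed with
`ShellMeasureRootCompositionSync.shellWeightBound_of_slotAC_sync`.  Displayed remain: the a.e. closeness under each
run's weights (node U1b type), THE WALL (M1) per slot per run for the `s`-small partial laws, the window
`LiveWindow C lvl N₁ ν̄` (SM-L7), `D ≤ D̄`, the rate `ρ_j ≤ c₁ϑ^j` (SM-L8, node U1b BY NAME, c4).  CONCLUSION: LITERALLY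
`T4IndicatorShell.ShellWeightBound l₀ T A B shA shB Wsh` with END-I's `Wsh`.  CONDITIONAL; nothing printed asserted.
[folklore] -/
theorem shellWeightBound_histories_sync (huA : ∀ K t s, Measurable (uA K t s))
    (huB : ∀ K t s, Measurable (uB K t s)) (hsmall : ∀ K, ∀ τ ∈ T K, small K τ ⊆ C K)
    (hcloseA : ∀ K t, |t| ≤ l₀ → ∀ τ ∈ T K, ∀ s ∈ small K τ,
      ∀ᵐ ω ∂(νA K t τ), |uA K t s ω - uB K t s ω| ≤ ρ (lvl K s) * θ K s)
    (hcloseB : ∀ K t, |t| ≤ l₀ → ∀ τ ∈ T K, ∀ s ∈ small K τ,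
      ∀ᵐ ω ∂(νB K t τ), |uB K t s ω - uA K t s ω| ≤ ρ (lvl K s) * θ K s)
    (hDA0 : ∀ j, 0 ≤ DA j) (hDB0 : ∀ j, 0 ≤ DB j) (hρ0 : ∀ j, 0 ≤ ρ j)
    (hacA : ∀ K t, |t| ≤ l₀ → ∀ s ∈ C K,
      SlotAntiConcentration (partialLaw (T K) (νA K t) (small K) (uA K t) (θ K) s) (uA K t s)
        (θ K s) (ρ (lvl K s)) (DA (lvl K s)))
    (hacB : ∀ K t, |t| ≤ l₀ → ∀ s ∈ C K,
      SlotAntiConcentration (partialLaw (T K) (νB K t) (small K) (uB K t) (θ K) s) (uB K t s)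
        (θ K s) (ρ (lvl K s)) (DB (lvl K s)))
    (hw : LiveWindow C lvl N₁ νbar) (hϑ0 : 0 < ϑ) (hϑ1 : ϑ < 1)
    (hDA : ∀ j, DA j ≤ Dbar) (hDB : ∀ j, DB j ≤ Dbar) (hrate : ∀ j, ρ j ≤ c₁ * ϑ ^ j) :
    ShellWeightBound l₀ T
      (fun K t τ => histWeight (νA K t τ) (small K τ) (uA K t) (θ K))
      (fun K t τ => histWeight (νB K t τ) (small K τ) (uB K t) (θ K))
      (fun K t τ => histShell (νA K t τ) (small K τ) (uA K t) (uB K t) (θ K))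
      (fun K t τ => histShell (νB K t τ) (small K τ) (uB K t) (uA K t) (θ K))
      (fun K => ∑ s ∈ C K, DA (lvl K s) * ρ (lvl K s) + ∑ s ∈ C K, DB (lvl K s) * ρ (lvl K s)) := by
  haveI : ∀ K t s, IsFiniteMeasure (partialLaw (T K) (νA K t) (small K) (uA K t) (θ K) s) :=
    fun K t s => isFiniteMeasure_partialLaw _ _ _ _ _ _
  haveI : ∀ K t s, IsFiniteMeasure (partialLaw (T K) (νB K t) (small K) (uB K t) (θ K) s) :=
    fun K t s => isFiniteMeasure_partialLaw _ _ _ _ _ _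
  exact shellWeightBound_of_slotAC_sync (ΩA := fun K _ => Ω K) (ΩB := fun K _ => Ω K)
    (μA := fun K t s => partialLaw (T K) (νA K t) (small K) (uA K t) (θ K) s)
    (μB := fun K t s => partialLaw (T K) (νB K t) (small K) (uB K t) (θ K) s)
    (uA := fun K t s => uA K t s) (uB := fun K t s => uB K t s) (θA := θ) (θB := θ)
    (MA := fun _ _ _ => (1 : ℝ)) (MB := fun _ _ _ => (1 : ℝ))
    (pieceA := fun K t s τ => histPiece (νA K t τ) (small K τ) (uA K t) (uB K t) (θ K) s)
    (pieceB := fun K t s τ => histPiece (νB K t τ) (small K τ) (uB K t) (uA K t) (θ K) s)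
    (sh_nonneg_sync T small νA uA uB θ l₀) (sh_le_sync T small νA uA uB θ l₀ huA)
    (cover_sync T C small νA uA uB θ l₀ huA huB hsmall) (ShellMeasureRootCompositionPushCubes.M_nonneg C l₀)
    (piece_le_sync T C small lvl νA uA uB θ ρ l₀ huA hcloseA) (total_ge_sync T C small νA uA θ l₀ huA) hDA0 hρ0 hacA
    (sh_nonneg_sync T small νB uB uA θ l₀) (sh_le_sync T small νB uB uA θ l₀ huB)
    (cover_sync T C small νB uB uA θ l₀ huB huA hsmall) (ShellMeasureRootCompositionPushCubes.M_nonneg C l₀)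
    (piece_le_sync T C small lvl νB uB uA θ ρ l₀ huB hcloseB) (total_ge_sync T C small νB uB θ l₀ huB) hDB0 hρ0 hacB
    hw hw hϑ0 hϑ1 hDA hDB hrate hrate

/-- **END-I, BAND FORM (road P2's head, c6), THRESHOLDS BY SLOT**: the same conclusion from `Summable ρ` and
age-resolved live-slot counts `#{s ∈ C K : K − lvl s = a} ≤ m a` (`a ≤ N₁`) in place of the geometric rate — two
`levelLedger_histories_sync` ledgers into `ShellMeasureBandCount.shellWeightBound_of_levels_band`. [folklore] -/
theorem shellWeightBound_histories_sync_band (huA : ∀ K t s, Measurable (uA K t s))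
    (huB : ∀ K t s, Measurable (uB K t s)) (hsmall : ∀ K, ∀ τ ∈ T K, small K τ ⊆ C K)
    (hcloseA : ∀ K t, |t| ≤ l₀ → ∀ τ ∈ T K, ∀ s ∈ small K τ,
      ∀ᵐ ω ∂(νA K t τ), |uA K t s ω - uB K t s ω| ≤ ρ (lvl K s) * θ K s)
    (hcloseB : ∀ K t, |t| ≤ l₀ → ∀ τ ∈ T K, ∀ s ∈ small K τ,
      ∀ᵐ ω ∂(νB K t τ), |uB K t s ω - uA K t s ω| ≤ ρ (lvl K s) * θ K s)
    (hDA0 : ∀ j, 0 ≤ DA j) (hDB0 : ∀ j, 0 ≤ DB j) (hρ0 : ∀ j, 0 ≤ ρ j)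
    (hacA : ∀ K t, |t| ≤ l₀ → ∀ s ∈ C K,
      SlotAntiConcentration (partialLaw (T K) (νA K t) (small K) (uA K t) (θ K) s) (uA K t s)
        (θ K s) (ρ (lvl K s)) (DA (lvl K s)))
    (hacB : ∀ K t, |t| ≤ l₀ → ∀ s ∈ C K,
      SlotAntiConcentration (partialLaw (T K) (νB K t) (small K) (uB K t) (θ K) s) (uB K t s)
        (θ K s) (ρ (lvl K s)) (DB (lvl K s)))
    (hw : LiveWindow C lvl N₁ νbar) (hDA : ∀ j, DA j ≤ Dbar) (hDB : ∀ j, DB j ≤ Dbar)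
    (hm : ∀ K, ∀ a ≤ N₁, (((C K).filter fun s => K - lvl K s = a).card : ℝ) ≤ m a) (hρ : Summable ρ) :
    ShellWeightBound l₀ T
      (fun K t τ => histWeight (νA K t τ) (small K τ) (uA K t) (θ K))
      (fun K t τ => histWeight (νB K t τ) (small K τ) (uB K t) (θ K))
      (fun K t τ => histShell (νA K t τ) (small K τ) (uA K t) (uB K t) (θ K))
      (fun K t τ => histShell (νB K t τ) (small K τ) (uB K t) (uA K t) (θ K))
      (fun K => ∑ s ∈ C K, DA (lvl K s) * ρ (lvl K s) + ∑ s ∈ C K, DB (lvl K s) * ρ (lvl K s)) :=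
  shellWeightBound_of_levels_band
    (levelLedger_histories_sync huA huB hsmall hcloseA hDA0 hρ0 hacA)
    (levelLedger_histories_sync huB huA hsmall hcloseB hDB0 hρ0 hacB)
    hw hw hDA hDB hm hm hρ hρ

/-! ## §8 Nothing landed is lost; the D8 instance (thresholds by AGE) -/

/-- NOTHING LANDED IS LOST (ledger): file 2's level-indexed `levelLedger_histories` (thresholds `θ' (lvl K s)`) IS
`levelLedger_histories_sync` at `θ K s := θ' (lvl K s)` — same binders, same conclusion. [folklore] -/
example {θ' D : ℕ → ℝ} (huA : ∀ K t s, Measurable (uA K t s)) (huB : ∀ K t s, Measurable (uB K t s))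
    (hsmall : ∀ K, ∀ τ ∈ T K, small K τ ⊆ C K)
    (hclose : ∀ K t, |t| ≤ l₀ → ∀ τ ∈ T K, ∀ s ∈ small K τ,
      ∀ᵐ ω ∂(νA K t τ), |uA K t s ω - uB K t s ω| ≤ ρ (lvl K s) * θ' (lvl K s))
    (hD : ∀ j, 0 ≤ D j) (hρ : ∀ j, 0 ≤ ρ j)
    (hac : ∀ K t, |t| ≤ l₀ → ∀ s ∈ C K,
      SlotAntiConcentration (partialLaw (T K) (νA K t) (small K) (uA K t) (fun s => θ' (lvl K s)) s) (uA K t s)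
        (θ' (lvl K s)) (ρ (lvl K s)) (D (lvl K s))) :
    LevelLedger l₀ T (fun K t τ => histWeight (νA K t τ) (small K τ) (uA K t) (fun s => θ' (lvl K s)))
      (fun K t τ => histShell (νA K t τ) (small K τ) (uA K t) (uB K t) (fun s => θ' (lvl K s))) C
      (fun K t s τ => histPiece (νA K t τ) (small K τ) (uA K t) (uB K t) (fun s => θ' (lvl K s)) s) lvl D ρ :=
  levelLedger_histories_sync (θ := fun K s => θ' (lvl K s)) huA huB hsmall hclose hD hρ hac

/-- NOTHING LANDED IS LOST (END): file 2's `shellWeightBound_histories` IS `shellWeightBound_histories_sync` at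
`θ K s := θ' (lvl K s)`. [folklore] -/
example {θ' : ℕ → ℝ} (huA : ∀ K t s, Measurable (uA K t s)) (huB : ∀ K t s, Measurable (uB K t s))
    (hsmall : ∀ K, ∀ τ ∈ T K, small K τ ⊆ C K)
    (hcloseA : ∀ K t, |t| ≤ l₀ → ∀ τ ∈ T K, ∀ s ∈ small K τ,
      ∀ᵐ ω ∂(νA K t τ), |uA K t s ω - uB K t s ω| ≤ ρ (lvl K s) * θ' (lvl K s))
    (hcloseB : ∀ K t, |t| ≤ l₀ → ∀ τ ∈ T K, ∀ s ∈ small K τ,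
      ∀ᵐ ω ∂(νB K t τ), |uB K t s ω - uA K t s ω| ≤ ρ (lvl K s) * θ' (lvl K s))
    (hDA0 : ∀ j, 0 ≤ DA j) (hDB0 : ∀ j, 0 ≤ DB j) (hρ0 : ∀ j, 0 ≤ ρ j)
    (hacA : ∀ K t, |t| ≤ l₀ → ∀ s ∈ C K,
      SlotAntiConcentration (partialLaw (T K) (νA K t) (small K) (uA K t) (fun s => θ' (lvl K s)) s) (uA K t s)
        (θ' (lvl K s)) (ρ (lvl K s)) (DA (lvl K s)))
    (hacB : ∀ K t, |t| ≤ l₀ → ∀ s ∈ C K,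
      SlotAntiConcentration (partialLaw (T K) (νB K t) (small K) (uB K t) (fun s => θ' (lvl K s)) s) (uB K t s)
        (θ' (lvl K s)) (ρ (lvl K s)) (DB (lvl K s)))
    (hw : LiveWindow C lvl N₁ νbar) (hϑ0 : 0 < ϑ) (hϑ1 : ϑ < 1)
    (hDA : ∀ j, DA j ≤ Dbar) (hDB : ∀ j, DB j ≤ Dbar) (hrate : ∀ j, ρ j ≤ c₁ * ϑ ^ j) :
    ShellWeightBound l₀ T
      (fun K t τ => histWeight (νA K t τ) (small K τ) (uA K t) (fun s => θ' (lvl K s)))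
      (fun K t τ => histWeight (νB K t τ) (small K τ) (uB K t) (fun s => θ' (lvl K s)))
      (fun K t τ => histShell (νA K t τ) (small K τ) (uA K t) (uB K t) (fun s => θ' (lvl K s)))
      (fun K t τ => histShell (νB K t τ) (small K τ) (uB K t) (uA K t) (fun s => θ' (lvl K s)))
      (fun K => ∑ s ∈ C K, DA (lvl K s) * ρ (lvl K s) + ∑ s ∈ C K, DB (lvl K s) * ρ (lvl K s)) :=
  shellWeightBound_histories_sync (θ := fun K s => θ' (lvl K s)) huA huB hsmall hcloseA hcloseB hDA0 hDB0 hρ0 hacA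
    hacB hw hϑ0 hϑ1 hDA hDB hrate

/-- **THE D8 INSTANCE — END-I FOR HISTORY-INDEXED TERMS WITH THRESHOLDS BY AGE.**  The threshold of slot `s` at
comparison `K` is the design value at its IR-anchored AGE, `ε (K − lvl K s)` for ONE profile `ε : ℕ → ℝ` common to the
two runs (under node U1b's `ReadsLevels` convention run B at comparison `K` is the `(K+1)`-step run and its
level-`(lvl K s + 1)` slot is paired with run A's level-`lvl K s` slot — the same age `K − lvl K s`; nothing about `ε` is
assumed, in particular no identification with `T4SyncThresholds.oneLoopRef` is made here).  This is the instantiation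
that the level-indexed END of file 2 can express only at window depth `N₁ = 0`
(`ShellMeasureRootCompositionSync.window_depth_zero_of_levelIndexed_oneLoopRef`).  Binders and conclusion otherwise
those of `shellWeightBound_histories_sync`.  CONDITIONAL; nothing printed asserted. [folklore] -/
theorem shellWeightBound_histories_age {ε : ℕ → ℝ} (huA : ∀ K t s, Measurable (uA K t s))
    (huB : ∀ K t s, Measurable (uB K t s)) (hsmall : ∀ K, ∀ τ ∈ T K, small K τ ⊆ C K)
    (hcloseA : ∀ K t, |t| ≤ l₀ → ∀ τ ∈ T K, ∀ s ∈ small K τ,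
      ∀ᵐ ω ∂(νA K t τ), |uA K t s ω - uB K t s ω| ≤ ρ (lvl K s) * ε (K - lvl K s))
    (hcloseB : ∀ K t, |t| ≤ l₀ → ∀ τ ∈ T K, ∀ s ∈ small K τ,
      ∀ᵐ ω ∂(νB K t τ), |uB K t s ω - uA K t s ω| ≤ ρ (lvl K s) * ε (K - lvl K s))
    (hDA0 : ∀ j, 0 ≤ DA j) (hDB0 : ∀ j, 0 ≤ DB j) (hρ0 : ∀ j, 0 ≤ ρ j)
    (hacA : ∀ K t, |t| ≤ l₀ → ∀ s ∈ C K,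
      SlotAntiConcentration (partialLaw (T K) (νA K t) (small K) (uA K t) (fun s => ε (K - lvl K s)) s) (uA K t s)
        (ε (K - lvl K s)) (ρ (lvl K s)) (DA (lvl K s)))
    (hacB : ∀ K t, |t| ≤ l₀ → ∀ s ∈ C K,
      SlotAntiConcentration (partialLaw (T K) (νB K t) (small K) (uB K t) (fun s => ε (K - lvl K s)) s) (uB K t s)
        (ε (K - lvl K s)) (ρ (lvl K s)) (DB (lvl K s)))
    (hw : LiveWindow C lvl N₁ νbar) (hϑ0 : 0 < ϑ) (hϑ1 : ϑ < 1)
    (hDA : ∀ j, DA j ≤ Dbar) (hDB : ∀ j, DB j ≤ Dbar) (hrate : ∀ j, ρ j ≤ c₁ * ϑ ^ j) :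
    ShellWeightBound l₀ T
      (fun K t τ => histWeight (νA K t τ) (small K τ) (uA K t) (fun s => ε (K - lvl K s)))
      (fun K t τ => histWeight (νB K t τ) (small K τ) (uB K t) (fun s => ε (K - lvl K s)))
      (fun K t τ => histShell (νA K t τ) (small K τ) (uA K t) (uB K t) (fun s => ε (K - lvl K s)))
      (fun K t τ => histShell (νB K t τ) (small K τ) (uB K t) (uA K t) (fun s => ε (K - lvl K s)))
      (fun K => ∑ s ∈ C K, DA (lvl K s) * ρ (lvl K s) + ∑ s ∈ C K, DB (lvl K s) * ρ (lvl K s)) :=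
  shellWeightBound_histories_sync (θ := fun K s => ε (K - lvl K s)) huA huB hsmall hcloseA hcloseB hDA0 hDB0 hρ0
    hacA hacB hw hϑ0 hϑ1 hDA hDB hrate

end TwoRuns

end Summit.QuantumFields.BalabanUV.T4Continuum.ShellMeasureRootCompositionHistoriesSync

end
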